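import Mathlib
import HarnessLib
import Summits.ResolutionOfSingularities.ResolutionOfSingularities.Theorems.WildQuotientsWildQuotientResolutionS1aQhSymAbsRoot
import Summits.ResolutionOfSingularities.ResolutionOfSingularities.Theorems.WildQuotientsWildQuotientResolutionS1aQhAbsCover
import Summits.ResolutionOfSingularities.ResolutionOfSingularities.Theorems.WildQuotientsWildQuotientResolutionS1aChartRingSigma

/-!
# S1a — R4c cusp, brick (b3-Z): the `σ_R`-FIXED BIHOMOGENEOUS ELEMENT `Z = N_R(u₂′)·N_R(ĥ)` of `R^w` inverted by the member chart `U_O`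

[OURS · L1 W4.5c · lead-1 g17; plan-1 RULING R-F15v (2) ★ R4c `cusp_killsIn_two`, memo `Cruxes/CyclicQuotientFourfolds/Lines/s1a_logminvertex-R4c-PROGRESS.md` §2/§4: input
`Z` of ✓`FreeModel.bHat_mem_chartNodeGrading_zero` / `sigmaChart_bHat` / `associated_map_bHat` for the O-side member chart `U_O = [N(x₁)] ∩ D(N(x₂)) ∩ D(N(h_O))`:
in the Rees ring `R^w` of the two-moving-generator root (✓QhSymAbsRoot: `σ_R u₂′ = u₂′ + s^sh u₀′`, `σ_R u₁′ = u₁′ + s^sh u₀′ s^{w₀−w₁−sh}`), the intrinsic norms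
`N_R(z) = ∏_{j<p} σ_Rʲ z` of `u₂′` and of `ĥ = 2u₂′ − 3s·u₁′²` (the member-row unit `h_O` read in `R^w`) are `σ_R`-fixed (✓`QhAbs.qha_normTail_fixed` with
✓`sigmaR_iterate_eq`) and bihomogeneous of bidegree `(p·w₂, 0)` resp. `(p·3, 0)` when `w = (9,2,3)` (`ĥ` has bidegree `(3,0)`)] — NOT statements of the manuscript;
counted 0; AI-level work, weaker than expert review. Crux stmt-ResolutionOfSingularities-17941 `CyclicQuotientFourfolds`, line `s1a-logminvertex` v13 (`stub_reachLowerInFX`).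
-/

set_option linter.dupNamespace false

noncomputable section

open Literature.AlgebraicGeometry.Resolution
open scoped LaurentPolynomial
open Summit.ResolutionOfSingularities.ResolutionOfSingularities.Theorems.WildQuotientResolution.S1
open Summit.ResolutionOfSingularities.ResolutionOfSingularities.Theorems.WildQuotientResolution.S1.CoarseChart
open Summit.ResolutionOfSingularities.ResolutionOfSingularities.Theorems.WildQuotientResolution.S1.ReesBigrading
open Summit.ResolutionOfSingularities.ResolutionOfSingularities.Theorems.WildQuotientResolution.S1.BlowupCharts
open Summit.ResolutionOfSingularities.ResolutionOfSingularities.Theorems.WildQuotientResolution.S1.GameFrame.GModel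

namespace Summit.ResolutionOfSingularities.ResolutionOfSingularities.Theorems.WildQuotientResolution.S1.KillCert.QhSym

variable {L : Type} [CommRing L] (τ : L ≃+* L) (f : Fin 3 → L) (w : Fin 3 → ℕ)
  {p : ℕ} (hp : 0 < p) (hσp : ∀ x : L, (⇑τ)^[p] x = x)
  (hσJ : ∀ n : ℕ, ((weightedFiltration f w).ideal n).map (τ : L →+* L) ≤ (weightedFiltration f w).ideal n)

/-- **Intrinsic `σ_R`-norms are `σ_R`-fixed**: `σ_R (∏_{j<p} σ_Rʲ z) = ∏_{j<p} σ_Rʲ z` for every `z ∈ R^w`. [OURS · L1 W4.5c · R4c] -/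
theorem sigmaR_normR_fixed [NeZero p] (z : ↥(cobordantAlgebra f w)) : (sigmaR τ f w hσJ hp hσp) (∏ j : ZMod p, (⇑(sigmaR τ f w hσJ hp hσp))^[j.val] z) = ∏ j : ZMod p, (⇑(sigmaR τ f w hσJ hp hσp))^[j.val] z :=
  QhAbs.qha_normTail_fixed (sigmaR τ f w hσJ hp hσp) z (sigmaR_iterate_eq τ f w hσJ hp hσp)

/-- Products of intrinsic norms are `σ_R`-fixed. -/
theorem sigmaR_normR_mul_fixed [NeZero p] (z z' : ↥(cobordantAlgebra f w)) :
    (sigmaR τ f w hσJ hp hσp) ((∏ j : ZMod p, (⇑(sigmaR τ f w hσJ hp hσp))^[j.val] z) * ∏ j : ZMod p, (⇑(sigmaR τ f w hσJ hp hσp))^[j.val] z') = (∏ j : ZMod p, (⇑(sigmaR τ f w hσJ hp hσp))^[j.val] z) * ∏ j : ZMod p, (⇑(sigmaR τ f w hσJ hp hσp))^[j.val] z' := by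
  rw [map_mul, sigmaR_normR_fixed, sigmaR_normR_fixed]

section Degrees

variable {m : ℕ} (mo : Fin m → ℕ) (𝒜 : (Π j : Fin m, ZMod (mo j)) → AddSubgroup L) [GradedRing 𝒜] (hσ𝒜 : ∀ (i : Π j : Fin m, ZMod (mo j)) (x : L), x ∈ 𝒜 i → τ x ∈ 𝒜 i)
  (hf : ∀ i, f i ∈ 𝒜 ((fun _ => (0 : Π j : Fin m, ZMod (mo j))) i))

omit [GradedRing 𝒜] in
include hσ𝒜 in
/-- When `σ` is graded, every `σ_R`-iterate preserves bidegrees. -/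
theorem iterate_sigmaR_mem_reesPiece {e : ℤ × (Π j : Fin m, ZMod (mo j))} {z : ↥(cobordantAlgebra f w)} (hz : z ∈ reesPiece 𝒜 f w e) (n : ℕ) :
    (⇑(sigmaR τ f w hσJ hp hσp))^[n] z ∈ reesPiece 𝒜 f w e := by
  induction n with
  | zero => exact hz
  | succ n ih => rw [Function.iterate_succ_apply']; exact sigmaR_mem_reesPiece 𝒜 f w τ hσJ hp hσp hσ𝒜 ih

include hσ𝒜 hf in
/-- **Bidegree of an intrinsic norm**: `∏_{j<p} σ_Rʲ z` has bidegree `(a·p, 0)` for `z` of bidegree `(a, 0)`. -/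
theorem normR_mem_reesPiece [NeZero p] {a : ℕ} {z : ↥(cobordantAlgebra f w)} (hz : z ∈ reesPiece 𝒜 f w (((a : ℕ) : ℤ), (0 : Π j : Fin m, ZMod (mo j)))) :
    (∏ j : ZMod p, (⇑(sigmaR τ f w hσJ hp hσp))^[j.val] z) ∈ reesPiece 𝒜 f w ((((a * p : ℕ)) : ℤ), (0 : Π j : Fin m, ZMod (mo j))) := by
  classical
  letI := reesGradedRing 𝒜 f w hf
  have h := SetLike.prod_mem_graded (A := reesPiece 𝒜 f w) (i := fun _ => ((((a : ℕ)) : ℤ), (0 : Π j : Fin m, ZMod (mo j)))) (g := fun j : ZMod p => (⇑(sigmaR τ f w hσJ hp hσp))^[j.val] z)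
    (F := Finset.univ) (fun j _ => iterate_sigmaR_mem_reesPiece τ f w hp hσp hσJ mo 𝒜 hσ𝒜 hz j.val)
  have e1 : ∑ _j ∈ (Finset.univ : Finset (ZMod p)), ((((a : ℕ)) : ℤ), (0 : Π j : Fin m, ZMod (mo j))) = ((((a * p : ℕ)) : ℤ), (0 : Π j : Fin m, ZMod (mo j))) := by
    rw [Finset.sum_const, Finset.card_univ, ZMod.card, Prod.ext_iff]
    exact ⟨by change p • ((a : ℕ) : ℤ) = _; rw [nsmul_eq_mul]; push_cast; ring, by rw [Prod.smul_snd, smul_zero]⟩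
  rwa [e1] at h

include hf in
/-- **`ĥ = 2u₂′ − 3s·u₁′²` has bidegree `(3, 0)`** for the cusp weights `w = (9, 2, 3)`. -/
theorem hHat_mem_reesPiece (hw1 : w 1 = 2) (hw2' : w 2 = 3) : (2 * (cobordantAlgebra.u' f w 2) - 3 * (cobordantAlgebra.s f w) * (cobordantAlgebra.u' f w 1) ^ 2 : ↥(cobordantAlgebra f w)) ∈ reesPiece 𝒜 f w (((3 : ℕ) : ℤ), (0 : Π j : Fin m, ZMod (mo j))) := by
  letI := reesGradedRing 𝒜 f w hf
  have hu2 : (cobordantAlgebra.u' f w 2) ∈ reesPiece 𝒜 f w (((3 : ℕ) : ℤ), (0 : Π j : Fin m, ZMod (mo j))) := by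
    have h := u'_mem_reesPiece 𝒜 f (δ := fun _ => (0 : Π j : Fin m, ZMod (mo j))) w hf 2
    rwa [hw2'] at h
  have hu1 : (cobordantAlgebra.u' f w 1) ∈ reesPiece 𝒜 f w (((2 : ℕ) : ℤ), (0 : Π j : Fin m, ZMod (mo j))) := by
    have h := u'_mem_reesPiece 𝒜 f (δ := fun _ => (0 : Π j : Fin m, ZMod (mo j))) w hf 1
    rwa [hw1] at h
  have hs : (cobordantAlgebra.s f w) ∈ reesPiece 𝒜 f w (-1, (0 : Π j : Fin m, ZMod (mo j))) := s_mem_reesPiece 𝒜 f w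
  have h2 : (2 : ↥(cobordantAlgebra f w)) ∈ reesPiece 𝒜 f w 0 := SetLike.natCast_mem_graded _ 2
  have h3 : (3 : ↥(cobordantAlgebra f w)) ∈ reesPiece 𝒜 f w 0 := SetLike.natCast_mem_graded _ 3
  have hA : 2 * (cobordantAlgebra.u' f w 2) ∈ reesPiece 𝒜 f w (((3 : ℕ) : ℤ), (0 : Π j : Fin m, ZMod (mo j))) := by
    have h := SetLike.mul_mem_graded h2 hu2
    rwa [zero_add] at h
  have hB : 3 * (cobordantAlgebra.s f w) * (cobordantAlgebra.u' f w 1) ^ 2 ∈ reesPiece 𝒜 f w (((3 : ℕ) : ℤ), (0 : Π j : Fin m, ZMod (mo j))) := by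
    have h := SetLike.mul_mem_graded (SetLike.mul_mem_graded h3 hs) (SetLike.pow_mem_graded 2 hu1)
    have e1 : (0 : ℤ × (Π j : Fin m, ZMod (mo j))) + (-1, (0 : Π j : Fin m, ZMod (mo j))) + 2 • ((((2 : ℕ)) : ℤ), (0 : Π j : Fin m, ZMod (mo j))) = (((3 : ℕ) : ℤ), (0 : Π j : Fin m, ZMod (mo j))) := by
      refine Prod.ext ?_ ?_
      · change (0 : ℤ) + -1 + 2 • (((2 : ℕ) : ℤ)) = ((3 : ℕ) : ℤ); norm_num
      · change ((0 : Π j : Fin m, ZMod (mo j)) + (0 : Π j : Fin m, ZMod (mo j))) + 2 • (0 : Π j : Fin m, ZMod (mo j)) = (0 : Π j : Fin m, ZMod (mo j)); rw [add_zero, smul_zero, add_zero]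
    rwa [e1] at h
  exact sub_mem hA hB

end Degrees

end Summit.ResolutionOfSingularities.ResolutionOfSingularities.Theorems.WildQuotientResolution.S1.KillCert.QhSym

end
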